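/-
Copyright (c) 2026 the pub-hodgecm-mathlib formalisation cell (harness21).  Prover seat hodgecm-mathlib-LH1-p01 (g12) on the N8-INNER road (ROAD B «EP road», road owner
LH2-plan (g1)), brick (8) «WALL EP GENERATOR», part (8b′): Weyl separation at a two-block diagonal point and the slice generator at a compact-chart WALL point of `U(α)_w`; 2026-09-02.
-/
import Literature.NumberTheory.Automorphic.UnitarySliceGenerator           -- (this seat) (8b): `exists_sliceGenerator`
import Literature.NumberTheory.Automorphic.ArchInnerFormChartLocal          -- ★ one-place chart `gprimeBlockAt`, `archLocal`; brings ★ `ArchInnerFormCartanAtlas` (`coe_gprimeBlock_of_not_mem`, `coe_gprimeCptGL`)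
import Literature.LinearAlgebra.Matrix.BlockCentralizerNearScalar          -- ★ (W-s) A-p16: `eventually_commute_of_mul_eq_of_frame` (Weyl separation at `a·1 ⊕ u·1`, `a ≠ u`)
import HarnessLib

/-!
# The slice generator at a WALL point of the one-place unitary group `U(α)_w`: Weyl separation at a two-valued diagonal point, and ★ (8b) instantiated
# (Harish-Chandra descent at a semiregular element; Rogawski 1990 §8.2 Prop. 8.2.1; Varadarajan 1977 Part I §2)

Topic `NumberTheory/Automorphic`; namespace `Literature.NumberTheory.Automorphic.UnitaryGroup`.  THEOREMS ONLY (no definition, no instance, no notation, no axiom, no named fact, no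
`sorry`); kernel lane `--kind proof --supports stmt-HodgeConjecture-24833`.  Cell `pub/hodgecm-mathlib`, crux H413 = `stmt-HodgeConjecture-24833`; N8-INNER ROAD B, brick
**(8) «WALL EP GENERATOR (one place)»**, binder LH1-p01 (g12), part **(8b′)** (SIGSHEET v1.2 §(8a′)∕(8b): the `hW` and frame inputs of ★ `exists_sliceGenerator` at the wall).
Author LH1-p01 (g12).

THE MATHEMATICS.  At a compact-chart point `s = gprimeBlockAt L α w S′ cw₀` of `U(α)_w = U(σ_w diag α)(ℂ)` (`w ∉ S′`) lying ON the noncompact wall `(0,2)` (`cw₀ 0 = cw₀ 2`) and off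
the other walls at `w` (`e^{i cw₀ 1} ≠ e^{i cw₀ 0}`), the matrix of `s` is a unit diagonal with exactly TWO values `a = e^{i cw₀ 0}` (on the lines of slots `0, 2`) and
`u = e^{i cw₀ 1}` (slot `1`), `a ≠ u` (★ `coe_gprimeBlock_of_not_mem`, ★ `coe_gprimeCptGL`).  Hence: (i) `s` is annihilated by the separable polynomial `(X − a)(X − u)`; (ii) WEYL
SEPARATION holds at `s` — a two-valued diagonal matrix is the block scalar `a·1 ⊕ u·1` re-indexed along `Equiv.sumCompl`, so ★ (W-s) `eventually_commute_of_mul_eq_of_frame`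
(A-p16, Sylvester with a polynomial witness) applies with `P = 1`; (iii) `det (σ_w diag α) ≠ 0` for a nondegenerate frame.  Feeding (i)–(iii) to ★ (8b) `exists_sliceGenerator`
gives the SLICE GENERATOR AT THE WALL POINT with its fibration identity along the `Z(s)`-orbits of slice points — the object bricks (8c)∕(8d)∕(8e) turn into the one-place wall EP
generator of `EPGeneratorAt` (LH7-p01 (12′) E1).
* §1 `diagonal_eq_reindex_fromBlocks_of_two_values`, **`eventually_commute_of_mul_eq_of_diagonal_two_values`** (any field with a `T₁` ring topology; Weyl separation at a
  two-valued diagonal point), `separable_X_sub_C_mul_X_sub_C`, `aeval_diagonal_X_sub_C_mul_X_sub_C_eq_zero`.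
* §2 `coe_coe_gprimeBlockAt_of_not_mem` (the wall point's matrix), `isUnit_det_map_embedding_diagonal`, and the HEAD **`exists_sliceGenerator_gprimeBlockAt_wall`**.
HONEST LABEL: HC_CM is proved only modulo the 7 printed citations (2 remaining: hLiu418 = `stmt-HodgeConjecture-24832`, h413 = `stmt-HodgeConjecture-24833`) until rung 0 closes;
count-neutral (pays nothing by itself).

## References
* [Rogawski1990] J. D. Rogawski, *Automorphic Representations of Unitary Groups in Three Variables*, Ann. of Math. Stud. 123 (1990), §8.2 Prop. 8.2.1 pp. 112–116, §3.6 p. 28.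
* [Varadarajan1977] V. S. Varadarajan, *Harmonic Analysis on Real Reductive Groups*, LNM 576 (1977), Part I §2.
* [HornJohnson2013] R. A. Horn, C. R. Johnson, *Matrix Analysis*, 2nd ed. (2013), §2.4.4 (Sylvester: block-diagonal intertwiners).
-/

set_option autoImplicit false

noncomputable section

open Filter Topology Set Metric Polynomial NumberField NumberField.InfinitePlace
open scoped Matrix.Norms.Operator Matrix ContDiff

/-! ## §1 Two-valued diagonal matrices: frame, Weyl separation, the separable annihilator -/

namespace Literature.LinearAlgebra.Matrix

section TwoValues

variable {K : Type*} [Field K] {n : Type*} [Fintype n] [DecidableEq n]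

omit [Fintype n] in
open scoped Classical in
/-- A diagonal matrix with values in `{a, u}` is the block scalar `a·1 ⊕ u·1` re-indexed along `Equiv.sumCompl (d · = a)`. [cite: HornJohnson2013, §2.4.4] -/
theorem diagonal_eq_reindex_fromBlocks_of_two_values {d : n → K} {a u : K} (hd : ∀ i, d i = a ∨ d i = u) :
    Matrix.diagonal d = Matrix.reindex (Equiv.sumCompl fun i => d i = a) (Equiv.sumCompl fun i => d i = a)
      (Matrix.fromBlocks (a • (1 : Matrix {i // d i = a} {i // d i = a} K)) 0 0 (u • (1 : Matrix {i // ¬ d i = a} {i // ¬ d i = a} K))) := by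
  ext i j
  rw [Matrix.reindex_apply, Matrix.submatrix_apply]
  by_cases hi : d i = a <;> by_cases hj : d j = a
  · rw [Equiv.sumCompl_symm_apply_of_pos (p := fun i => d i = a) hi, Equiv.sumCompl_symm_apply_of_pos (p := fun i => d i = a) hj, Matrix.fromBlocks_apply₁₁, Matrix.smul_apply,
      Matrix.one_apply, Matrix.diagonal_apply]
    by_cases hij : i = j
    · subst hij; simp [hi]
    · have hne : (⟨i, hi⟩ : {i // d i = a}) ≠ ⟨j, hj⟩ := fun h => hij (congrArg Subtype.val h)
      simp [hij, hne]
  · rw [Equiv.sumCompl_symm_apply_of_pos (p := fun i => d i = a) hi, Equiv.sumCompl_symm_apply_of_neg (p := fun i => d i = a) hj, Matrix.fromBlocks_apply₁₂, Matrix.zero_apply,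
      Matrix.diagonal_apply]
    have hij : i ≠ j := fun h => hj (h ▸ hi)
    rw [if_neg hij]
  · rw [Equiv.sumCompl_symm_apply_of_neg (p := fun i => d i = a) hi, Equiv.sumCompl_symm_apply_of_pos (p := fun i => d i = a) hj, Matrix.fromBlocks_apply₂₁, Matrix.zero_apply,
      Matrix.diagonal_apply]
    have hij : i ≠ j := fun h => hi (h ▸ hj)
    rw [if_neg hij]
  · rw [Equiv.sumCompl_symm_apply_of_neg (p := fun i => d i = a) hi, Equiv.sumCompl_symm_apply_of_neg (p := fun i => d i = a) hj, Matrix.fromBlocks_apply₂₂, Matrix.smul_apply,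
      Matrix.one_apply, Matrix.diagonal_apply]
    by_cases hij : i = j
    · subst hij
      have hu : d i = u := (hd i).resolve_left hi
      simp [hu]
    · have hne : (⟨i, hi⟩ : {i // ¬ d i = a}) ≠ ⟨j, hj⟩ := fun h => hij (congrArg Subtype.val h)
      simp [hij, hne]

/-- **WEYL SEPARATION AT A TWO-VALUED DIAGONAL POINT**: near `(D, D)`, `D = diagonal d` with values in `{a, u}`, `a ≠ u`, an intertwiner `y q₁ = q₂ y` of two matrices commuting
with `D` commutes with `D` (★ (W-s) `eventually_commute_of_mul_eq_of_frame` with the frame `P = 1`). [cite: HornJohnson2013, §2.4.4 Cor. 2.4.4.2] [cite: Rogawski1990, §8.2 Prop. 8.2.1 pp. 112–116] -/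
theorem eventually_commute_of_mul_eq_of_diagonal_two_values [TopologicalSpace K] [IsTopologicalRing K] [T1Space K]
    {d : n → K} {a u : K} (hau : a ≠ u) (hd : ∀ i, d i = a ∨ d i = u) :
    ∀ᶠ q : Matrix n n K × Matrix n n K in 𝓝 (Matrix.diagonal d, Matrix.diagonal d),
      Commute q.1 (Matrix.diagonal d) → Commute q.2 (Matrix.diagonal d) → ∀ y : Matrix n n K, y * q.1 = q.2 * y → Commute y (Matrix.diagonal d) := by
  classical
  exact eventually_commute_of_mul_eq_of_frame hau (1 : GL n K) (Equiv.sumCompl fun i => d i = a)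
    (by rw [Units.val_one, Matrix.mul_one, Matrix.one_mul]; exact diagonal_eq_reindex_fromBlocks_of_two_values hd)

/-- `(X − a)(X − u)` is separable when `a ≠ u`. [cite: HornJohnson2013, §2.4.4] -/
theorem separable_X_sub_C_mul_X_sub_C {a u : K} (hau : a ≠ u) : ((X - C a) * (X - C u)).Separable :=
  separable_X_sub_C.mul separable_X_sub_C (isCoprime_X_sub_C_of_isUnit_sub (sub_ne_zero.2 hau).isUnit)

/-- A diagonal matrix with values in `{a, u}` is annihilated by `(X − a)(X − u)`. [cite: HornJohnson2013, §2.4.4] -/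
theorem aeval_diagonal_X_sub_C_mul_X_sub_C_eq_zero {d : n → K} {a u : K} (hd : ∀ i, d i = a ∨ d i = u) :
    aeval (Matrix.diagonal d) ((X - C a) * (X - C u)) = 0 := by
  have h1 : ∀ b : K, aeval (Matrix.diagonal d) (X - C b) = Matrix.diagonal fun i => d i - b := by
    intro b
    rw [map_sub, aeval_X, aeval_C, Algebra.algebraMap_eq_smul_one]
    ext i j
    by_cases hij : i = j
    · subst hij; simp
    · simp [hij]
  rw [map_mul, h1, h1, Matrix.diagonal_mul_diagonal]
  ext i j
  by_cases hij : i = j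
  · subst hij
    rcases hd i with h | h <;> simp [h]
  · simp [hij]

end TwoValues

end Literature.LinearAlgebra.Matrix

/-! ## §2 The slice generator at a compact-chart wall point of `U(α)_w` -/

namespace Literature.NumberTheory.Automorphic.UnitaryGroup

open Literature.NumberTheory.Automorphic Literature.LinearAlgebra.Matrix Literature.Analysis.Calculus

section Wall

variable (L : Type) [Field L] [NumberField L] [IsCMField L] (α : Fin 3 → L) (w : {w : InfinitePlace L // IsComplex w})
  (S' : Finset {w : InfinitePlace L // IsComplex w})

omit [NumberField L] [IsCMField L] in
/-- The matrix of the compact-chart point `gprimeBlockAt L α w S′ cw` (`w ∉ S′`): `diag(e^{i cw (τ⁻¹ ℓ)})`, `τ = lineOf (formSign L α w)`. [cite: Rogawski1990, §3.6 p. 28] -/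
theorem coe_coe_gprimeBlockAt_of_not_mem {w S'} (hw : w ∉ S') (cw : Fin 3 → ℝ) :
    (((gprimeBlockAt L α w S' cw : ↥(archLocal L 3 (Matrix.diagonal α) w)) : GL (Fin 3) ℂ) : Matrix (Fin 3) (Fin 3) ℂ) =
      Matrix.diagonal fun ℓ => Complex.exp ((cw ((lineOf (formSign L α w)).symm ℓ) : ℂ) * Complex.I) := by
  rw [show gprimeBlockAt L α w S' cw = gprimeBlock L α w S' (fun _ => cw) from rfl, coe_gprimeBlock_of_not_mem L α _ hw, coe_gprimeCptGL]

omit [NumberField L] [IsCMField L] in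
/-- `det (σ_w diag α)` is a unit for a nondegenerate frame. [cite: Rogawski1990, §3.6 p. 28] -/
theorem isUnit_det_map_embedding_diagonal (hα : ∀ i, α i ≠ 0) :
    IsUnit ((Matrix.diagonal α).map w.1.embedding).det := by
  rw [Matrix.diagonal_map (map_zero _), Matrix.det_diagonal, isUnit_iff_ne_zero, Finset.prod_ne_zero_iff]
  intro i _
  exact (map_ne_zero w.1.embedding).2 (hα i)

omit [NumberField L] [IsCMField L] in
/-- **THE SLICE GENERATOR AT A WALL POINT OF `U(α)_w`.**  `α` a nondegenerate frame (`α_i ≠ 0`), `w ∉ S′`, `cw₀` ON the noncompact wall `(0,2)` of the compact chart at `w`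
(`cw₀ 0 = cw₀ 2`) and off the others (`e^{i cw₀ 1} ≠ e^{i cw₀ 0}`), `s := gprimeBlockAt L α w S′ cw₀`, `Z := Z_{U(α)_w}(s)`.  For every neighbourhood `U₀` of `↑s` there is a
neighbourhood `V₀` of `↑s` such that every ambient `C^∞` function `Φ` whose restriction to `Z` is supported in `V₀` yields `f, g : M₃(ℂ) → ℂ` (`C^∞`, compactly supported in `U₀`, `g` real
`≥ 0`, `g(s) = 1`) with the FIBRATION IDENTITY `f(x · ℓγ′ℓ⁻¹ · x⁻¹) = g(x s x⁻¹) · Φ(w · ℓγ′ℓ⁻¹ · w⁻¹)` (ONE `w ∈ Z` per `x`, all `ℓ ∈ Z`) for every slice point `γ′ ∈ Z ∩ V₀` —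
★ (8b) `exists_sliceGenerator` with its frame inputs (separable annihilator, Weyl separation, unit determinant) discharged at the wall point.
[cite: Rogawski1990, §8.2 Prop. 8.2.1 pp. 112–116] [cite: Varadarajan1977, Part I §2] [cite: HornJohnson2013, §2.4.4 Cor. 2.4.4.2] -/
theorem exists_sliceGenerator_gprimeBlockAt_wall (hα : ∀ i, α i ≠ 0) {w : {w : InfinitePlace L // IsComplex w}}
    {S' : Finset {w : InfinitePlace L // IsComplex w}} (hw : w ∉ S') (cw₀ : Fin 3 → ℝ) (h02 : cw₀ 0 = cw₀ 2)
    (h1 : Circle.exp (cw₀ 1) ≠ Circle.exp (cw₀ 0))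
    (U₀ : Set (Matrix (Fin 3) (Fin 3) ℂ)) (hU₀ : U₀ ∈ 𝓝 (((gprimeBlockAt L α w S' cw₀ : ↥(archLocal L 3 (Matrix.diagonal α) w)) : GL (Fin 3) ℂ) : Matrix (Fin 3) (Fin 3) ℂ)) :
    ∃ V₀ : Set (Matrix (Fin 3) (Fin 3) ℂ), V₀ ∈ 𝓝 (((gprimeBlockAt L α w S' cw₀ : ↥(archLocal L 3 (Matrix.diagonal α) w)) : GL (Fin 3) ℂ) : Matrix (Fin 3) (Fin 3) ℂ) ∧
      ∀ Φ : Matrix (Fin 3) (Fin 3) ℂ → ℂ, ContDiff ℝ ∞ Φ →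
        (∀ z : ↥(archLocal L 3 (Matrix.diagonal α) w), z ∈ Subgroup.centralizer ({gprimeBlockAt L α w S' cw₀} : Set ↥(archLocal L 3 (Matrix.diagonal α) w)) →
          Φ ((z : GL (Fin 3) ℂ) : Matrix (Fin 3) (Fin 3) ℂ) ≠ 0 → ((z : GL (Fin 3) ℂ) : Matrix (Fin 3) (Fin 3) ℂ) ∈ V₀) →
        ∃ (f g : Matrix (Fin 3) (Fin 3) ℂ → ℂ),
          ContDiff ℝ ∞ f ∧ HasCompactSupport f ∧ tsupport f ⊆ U₀ ∧
          ContDiff ℝ ∞ g ∧ HasCompactSupport g ∧ tsupport g ⊆ U₀ ∧ (∀ W, 0 ≤ (g W).re ∧ (g W).im = 0) ∧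
          g (((gprimeBlockAt L α w S' cw₀ : ↥(archLocal L 3 (Matrix.diagonal α) w)) : GL (Fin 3) ℂ) : Matrix (Fin 3) (Fin 3) ℂ) = 1 ∧
          ∀ γ' : ↥(archLocal L 3 (Matrix.diagonal α) w), γ' ∈ Subgroup.centralizer ({gprimeBlockAt L α w S' cw₀} : Set ↥(archLocal L 3 (Matrix.diagonal α) w)) →
            ((γ' : GL (Fin 3) ℂ) : Matrix (Fin 3) (Fin 3) ℂ) ∈ V₀ →
            ∀ x : ↥(archLocal L 3 (Matrix.diagonal α) w), ∃ v : ↥(archLocal L 3 (Matrix.diagonal α) w),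
              v ∈ Subgroup.centralizer ({gprimeBlockAt L α w S' cw₀} : Set ↥(archLocal L 3 (Matrix.diagonal α) w)) ∧
              ∀ ℓ : ↥(archLocal L 3 (Matrix.diagonal α) w), ℓ ∈ Subgroup.centralizer ({gprimeBlockAt L α w S' cw₀} : Set ↥(archLocal L 3 (Matrix.diagonal α) w)) →
                f (((x * (ℓ * γ' * ℓ⁻¹) * x⁻¹ : ↥(archLocal L 3 (Matrix.diagonal α) w)) : GL (Fin 3) ℂ) : Matrix (Fin 3) (Fin 3) ℂ) =
                  g (((x * gprimeBlockAt L α w S' cw₀ * x⁻¹ : ↥(archLocal L 3 (Matrix.diagonal α) w)) : GL (Fin 3) ℂ) : Matrix (Fin 3) (Fin 3) ℂ) *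
                    Φ (((v * (ℓ * γ' * ℓ⁻¹) * v⁻¹ : ↥(archLocal L 3 (Matrix.diagonal α) w)) : GL (Fin 3) ℂ) : Matrix (Fin 3) (Fin 3) ℂ) := by
  -- the two diagonal values
  set τ : Fin 3 ≃ Fin 3 := lineOf (formSign L α w) with hτ
  set d : Fin 3 → ℂ := fun ℓ => Complex.exp ((cw₀ (τ.symm ℓ) : ℂ) * Complex.I) with hd
  set a : ℂ := Complex.exp ((cw₀ 0 : ℂ) * Complex.I) with ha
  set u : ℂ := Complex.exp ((cw₀ 1 : ℂ) * Complex.I) with hu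
  have hau : a ≠ u := by
    intro h
    apply h1
    apply Subtype.ext
    rw [Circle.coe_exp, Circle.coe_exp]
    exact h.symm
  have hdau : ∀ ℓ, d ℓ = a ∨ d ℓ = u := by
    intro ℓ
    simp only [hd]
    generalize τ.symm ℓ = k
    fin_cases k
    · exact Or.inl rfl
    · exact Or.inr rfl
    · left; show Complex.exp ((cw₀ 2 : ℂ) * Complex.I) = a; rw [← h02]
  have hγd : (((gprimeBlockAt L α w S' cw₀ : ↥(archLocal L 3 (Matrix.diagonal α) w)) : GL (Fin 3) ℂ) : Matrix (Fin 3) (Fin 3) ℂ) = Matrix.diagonal d :=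
    coe_coe_gprimeBlockAt_of_not_mem L α hw cw₀
  -- the three frame inputs of ★ (8b)
  have hJ : IsUnit ((Matrix.diagonal α).map w.1.embedding).det := isUnit_det_map_embedding_diagonal L α w hα
  have hp : ((X - C a) * (X - C u)).Separable := separable_X_sub_C_mul_X_sub_C hau
  have hγp : aeval (((gprimeBlockAt L α w S' cw₀ : ↥(archLocal L 3 (Matrix.diagonal α) w)) : GL (Fin 3) ℂ) : Matrix (Fin 3) (Fin 3) ℂ) ((X - C a) * (X - C u)) = 0 := by
    rw [hγd]; exact aeval_diagonal_X_sub_C_mul_X_sub_C_eq_zero hdau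
  have hW : ∀ᶠ q : Matrix (Fin 3) (Fin 3) ℂ × Matrix (Fin 3) (Fin 3) ℂ in
      𝓝 ((((gprimeBlockAt L α w S' cw₀ : ↥(archLocal L 3 (Matrix.diagonal α) w)) : GL (Fin 3) ℂ) : Matrix (Fin 3) (Fin 3) ℂ),
        (((gprimeBlockAt L α w S' cw₀ : ↥(archLocal L 3 (Matrix.diagonal α) w)) : GL (Fin 3) ℂ) : Matrix (Fin 3) (Fin 3) ℂ)),
      Commute q.1 (((gprimeBlockAt L α w S' cw₀ : ↥(archLocal L 3 (Matrix.diagonal α) w)) : GL (Fin 3) ℂ) : Matrix (Fin 3) (Fin 3) ℂ) →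
      Commute q.2 (((gprimeBlockAt L α w S' cw₀ : ↥(archLocal L 3 (Matrix.diagonal α) w)) : GL (Fin 3) ℂ) : Matrix (Fin 3) (Fin 3) ℂ) →
      ∀ y : Matrix (Fin 3) (Fin 3) ℂ, y * q.1 = q.2 * y →
        Commute y (((gprimeBlockAt L α w S' cw₀ : ↥(archLocal L 3 (Matrix.diagonal α) w)) : GL (Fin 3) ℂ) : Matrix (Fin 3) (Fin 3) ℂ) := by
    rw [hγd]; exact eventually_commute_of_mul_eq_of_diagonal_two_values hau hdau
  exact exists_sliceGenerator (starRingEnd ℂ) Complex.continuous_conj hJ _ (gprimeBlockAt L α w S' cw₀).2 hp hγp hW U₀ hU₀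

end Wall

end Literature.NumberTheory.Automorphic.UnitaryGroup

end
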